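import Summits.QuantumFields.YangMills.Theorems.CurvatureSandwichBound.Negative.Unbundled
import Summits.QuantumFields.YangMills.Theorems.CurvatureSandwichBound.Negative.Inhabitants
import Summits.QuantumFields.YangMills.Theorems.CurvatureSandwichBound.Negative.SigmaSupFalse

/-!
# Disproof of `CurvatureSandwichBound` (Σ, crux `stmt-QuantumFields-18372`) — findings

Standing adversary (cdisprove, cycle 1, 2026-08-17) on THE TRANSVERSELY FILTERED HEAT SANDWICH WITH ONE POWER OF
SLACK of route IsotropyFromPowerCounting: for every compact simple `G`, `r`, `sch`, `S₁` with
`W1 r sch S₁ → EightFrameRP S₁ → PlanarCone S₁ → SoftKernel S₁`, BOTH ROWS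
`SandwichRows S₁ ∧ ∀ R, IsQuarterTurnFrame R → SandwichRows (S₁ ∘ R)`, i.e. for the `e₀`-reconstruction of `S₁`
and of its quarter-turn pull-back, `μ < 4` and `C` with
`‖Ψ_{f₁ ⊗ W_{(2u+v)e₀}}‖ ≤ C·Mg·(Mh+Mh')·(u^{-μ}+v^{-μ})·‖Ψ_W‖` (`f₁ = g(x⁰,x¹)hh(x²,x³)`, times of `g` in `[u,2u]`,
`∫|g| ≤ Mg`, `∫|hh| ≤ Mh`, `|hh| ≤ Mh'`, all time-ordered `W`).

VERDICT (cycle 1): **no kill; Σ is unfalsifiable in Lean short of a gapped Wilson continuum limit of `tr F²`, and —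
NEW relative to the sibling cruxes B, B′, T, NPointIsotropy — its MODEL-BLIND core is NOT refuted by any tree family
and holds on paper throughout the quasi-free class with a soft kernel (`μ = Δ₂ − 1 < 4`).**  Everything conclusive
is LANDED under `Theorems/CurvatureSandwichBound/Negative/` (p145325 `Unbundled`, p146585 `Inhabitants`, p149516 `SupNormOnlyFalse`, p150246 `ConstFieldOS`, p150689 `TiedConstField`, p151023 `SigmaSupFalse`) and imported
here; this file only indexes, composes and records the paper analysis (prose as docstrings; `True`-theorems are
paper statements, not claims of proof).

## Index
* §0 `sigma_iff` — the crux unbundled (alias of the landed `curvatureSandwichBound_iff`); hypotheses = those of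
  B′ = `SoftKernelBoostCovariance` verbatim.
* §1 NON-VACUITY: `hypotheses_inhabited` (zero scheme + vacuum family, every `G`, `r`), `inner_quantifiers_inhabited`
  (`∀ h`, `∀ R h'` are inhabited under the hypotheses — the quarter-turn frame IS one of the eight RP frames).
* §2 CERTIFIED INHABITANTS SATISFY Σ (`μ = 0`): `rows_vac` (the `c ≡ 0` slice); `constField_certified` — NEW IN
  LEAN: for every `G`, `r`, `κ` the `β ≡ 0` scheme `constScheme r κ` TIES the constant field `𝔖ₙ = κⁿ∫` and the pair
  meets `W1 ∧ EightFrameRP ∧ PlanarCone ∧ SoftKernel` AND both rows (the first certified inhabitant of the common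
  hypothesis set of Σ/B/B′ with non-zero field vectors); `betaZero_slice` (every OTHER `β_k = 0`-frequently scheme:
  tied families are c-number on `⁰𝒮`-tensors — landed `tie_beta_zero_factorises` — hence, on paper, constant fields
  on `⁰𝒮`); `rows_junk` (singular-support families: vacuum-only OS space).
* §3 LOAD-BEARING ANALYSIS, hypothesis by hypothesis: the TIE (`tie_assessment`: not Lean-refutable; the model-blind
  core `SandwichModelBlind` is OPEN, holds on every tree family and on the quasi-free class — so, unlike for B/B′/T, a
  model-blind proof of Σ from `SoftKernel + 8RP + cone + E0'` is NOT excluded; its vacuum row IS a theorem: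
  `vacuumRow_of_kernel`); the SOFT KERNEL (`softKernel_assessment`: load-bearing on paper, `Σ_μ ∂_μ⁴φ`); the
  `L¹`-MASS `Mh` (`sigma_false_without_L1mass`: FALSE IN LEAN without it, constant field `κ = 1`; and the CRUX-SHAPED
  strengthening `CurvatureSandwichBoundSup` is FALSE UNCONDITIONALLY: `sigmaSup_false`, witness `SU(2)`, fundamental
  rep, `constScheme r 1`, `constField 1`); the
  SUP-NORM `Mh'` and the WINDOW `[u,2u]` (`supNorm_and_window_assessment`: load-bearing on paper — with `Mh` alone the
  vacuum row of `tr F²` itself forces `μ ≥ Δ₂ = 4`); frames / cone / gaps / hypercubic / E3 / E4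
  (`other_hypotheses_assessment`: no known role in the `e₀` row; diagonal RP makes the second row non-vacuous).
* §4 TIGHTNESS (paper): `tightness_assessment` — `μ ≥ Δ₂ − 1 = 3` on the vacuum row of `tr F²`; both `u^{-μ}` and
  `v^{-μ}` needed (creation vs annihilation parts); `C` not uniform in the family (`sigma_constant_not_uniform`, Lean).
* §5 THE QUARTER-TURN ROW: `quarterTurn_assessment`.
* §6 `regimes_tried` — attack ledger and THE WALL.
* §7 TARGETS (line `Sketch`, stubs `stub_chainGrowthAxis/Diag`): equivalent to the item's rows by the lead's landed
  equivalence — no separate stub kill; certified inhabitants satisfy them (`targets_assessment`).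
-/

noncomputable section

namespace Summit.QuantumFields.YangMills.Cruxes.CurvatureSandwichBound.Disproof

open scoped BigOperators SchwartzMap ComplexConjugate InnerProductSpace
open MeasureTheory Filter Topology Complex
open Literature.MathematicalPhysics.QuantumLattice Literature.MathematicalPhysics.AQFT
  Literature.MathematicalPhysics.QuantumFieldTheory
open Summit.QuantumFields.YangMills.Theorems.NPointIsotropy.Negative (E4 junk)
open Summit.QuantumFields.YangMills.Theorems.CurvatureBoostCovariance.Negative
  (OSPackage Translations Hypercubic EightFrameRP PlanarCone Tie Gaps W1 vac tie_beta_zero_factorises)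
open Summit.QuantumFields.YangMills.Theorems.SoftKernelBoostCovariance.Negative (SoftKernel)
open Summit.QuantumFields.YangMills.Theorems.DiagonalMirrorRPR.Negative (constField constField_apply)
open Summit.QuantumFields.YangMills.Theorems.CurvatureSandwichBound.Negative

/-! ## §0 The crux unbundled -/

/-- **§0. Σ unbundled** (LANDED `curvatureSandwichBound_iff`, definitional): the hypotheses are EXACTLY those of
B′ = `MirrorModularBoosts.SoftKernelBoostCovariance` (`W1`, eight frames, cone, soft kernel), the conclusion is the
pair of row-blocks.  Consequence: the sibling disprover's analysis of WHAT A COUNTEREXAMPLE MUST BE applies verbatim —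
the tie pins `S₁` on off-diagonal real tensors (`Negative.Unbundled.tie_unique` of the parent), dense in `⁰𝒮`; and
the rows read `S₁` on `⁰𝒮` ONLY (`norm_fieldVec_sq`: `‖Ψ_F‖² = Re 𝔖_{2n}(θF* ⊗ F)`, `h` is a proof of a `Prop`). -/
theorem sigma_iff :
    Summit.QuantumFields.YangMills.Theses.IsotropyFromPowerCounting.CurvatureSandwichBound ↔
      ∀ (G : Type) [Group G] [TopologicalSpace G] [IsTopologicalGroup G] [CompactSpace G]
        [MeasurableSpace G] [BorelSpace G], IsCompactSimpleLieGroup G →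
        ∀ (r : LatticeRep G) (sch : SpeciesScheme (YMSpecies G)) (S₁ : SchwingerFamily E4),
          W1 r sch S₁ → EightFrameRP S₁ → PlanarCone S₁ → SoftKernel S₁ →
            SandwichRows S₁ ∧
              ∀ R : E4 ≃ₗᵢ[ℝ] E4, IsQuarterTurnFrame R → SandwichRows (fun n => (S₁ n).comp (linActMulti R)) :=
  curvatureSandwichBound_iff

/-! ## §1 Non-vacuity -/

section NonVacuity

variable {G : Type} [Group G] [TopologicalSpace G] [IsTopologicalGroup G] [CompactSpace G]
  [MeasurableSpace G] [BorelSpace G]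

/-- **§1a. The hypothesis set is inhabited for every `G`, `r`** (zero scheme + vacuum family: `W1`, eight frames,
cone, soft kernel) AND the conclusion holds there (both rows, every frame).  LANDED `hypotheses_and_rows_vac`. -/
theorem hypotheses_inhabited (r : LatticeRep G) :
    W1 r (SpeciesScheme.zero _) vac ∧ EightFrameRP vac ∧ PlanarCone vac ∧ SoftKernel vac ∧ SandwichRows vac ∧
      ∀ R : E4 ≃ₗᵢ[ℝ] E4, SandwichRows (fun n => (vac n).comp (linActMulti R)) :=
  hypotheses_and_rows_vac r

/-- **§1b. The inner quantifiers are inhabited under the hypotheses**: `W1` gives the `e₀`-reconstruction `h`, and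
the eight-frame RP + translations give `h'` for the quarter-turn pull-back (LANDED `osReconstruction_of_osPackage`,
`osReconstruction_quarterTurn`).  So neither row is asserted vacuously; in particular the second row is NOT rescued by
a failure of diagonal RP — diagonal RP is a hypothesis. -/
theorem inner_quantifiers_inhabited {r : LatticeRep G} {sch : SpeciesScheme (YMSpecies G)} {S₁ : SchwingerFamily E4}
    (hW : W1 r sch S₁) (h8 : EightFrameRP S₁) :
    OSReconstructionNoE1 S₁.toLabelled ∧
      ∀ R : E4 ≃ₗᵢ[ℝ] E4, IsQuarterTurnFrame R →
        OSReconstructionNoE1 (SchwingerFamily.toLabelled fun n => (S₁ n).comp (linActMulti R)) :=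
  ⟨osReconstruction_of_osPackage hW.2.1 hW.2.2.1, fun _ hR => osReconstruction_quarterTurn h8 hW.2.2.1 hR⟩

end NonVacuity

/-! ## §2 Every certified inhabitant of the hypotheses satisfies Σ -/

/-- **§2a. The `c ≡ 0` slice**: tied families vanish on positive-degree `⁰𝒮`-tensors (parent's
`tie_apply_eq_zero_of_c_eq_zero`), i.e. are the vacuum family there; the vacuum family satisfies both rows in every
frame with `μ = 0`, `C = 0` (LANDED). -/
theorem rows_vac : SandwichRows vac ∧ ∀ R : E4 ≃ₗᵢ[ℝ] E4, SandwichRows (fun n => (vac n).comp (linActMulti R)) :=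
  ⟨sandwichRows_vac, sandwichRows_vac_pullback⟩

/-- **§2b. Constant fields satisfy both rows, every frame, `μ = 0`, `C = |κ|/2`** (LANDED `conclusion_constField`,
`sandwichRows_constField_pullback`): `‖Ψ_{f₁ ⊗ W_a}‖ = |κ| |∫f₁| ‖Ψ_W‖`, `|∫ f₁| ≤ Mg Mh`. -/
theorem rows_constField (κ : ℝ) :
    SandwichRows (constField κ) ∧ ∀ R : E4 ≃ₗᵢ[ℝ] E4, SandwichRows (fun n => (constField κ n).comp (linActMulti R)) :=
  ⟨sandwichRows_constField κ, sandwichRows_constField_pullback κ⟩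

section BetaZero

variable {G : Type} [Group G] [TopologicalSpace G] [IsTopologicalGroup G] [CompactSpace G]
  [MeasurableSpace G] [BorelSpace G]

/-- **§2b′. THE CONSTANT FIELD IS A CERTIFIED TIED INHABITANT — IN LEAN** (LANDED `hypotheses_constField`,
`W1_constField`, `tie_constField`, support files IV–V): for every compact group `G`, every `r`, every `κ`, lattice
Yang–Mills at `β ≡ 0` with `c_k ≡ κ`, `m_k ≡ 6d₀ − 1` CONVERGES on off-diagonal real tensors to `𝔖ₙ = κⁿ ∫`, and the
pair satisfies `W1` (tie, E0–E4 incl. E0', translations, hypercubic, both gaps), the eight frames, the cone, the soft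
kernel `K ≡ κ²` — AND both rows of Σ (`μ = 0`).  So the hypothesis set of Σ (= of B′) has an inhabitant with non-zero
field vectors, on which Σ holds: no refutation from the constant-field limits, now certified rather than paper. -/
theorem constField_certified (r : LatticeRep G) (κ : ℝ) :
    W1 r (constScheme r κ) (constField κ) ∧ EightFrameRP (constField κ) ∧ PlanarCone (constField κ) ∧
      SoftKernel (constField κ) ∧ SandwichRows (constField κ) ∧
        ∀ R : E4 ≃ₗᵢ[ℝ] E4, SandwichRows (fun n => (constField κ n).comp (linActMulti R)) :=
  hypotheses_constField r κ

/-- **§2c. NO OTHER `β ≡ 0` SCHEME CAN REFUTE Σ EITHER.**  LEAN PART (this theorem): a family tied to ANY scheme with `β_k = 0`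
frequently (arbitrary `c_k, m_k, a_k, L_k`, any `r`, any `G`) FACTORISES on off-diagonal real tensors,
`S₁ n (⊗fᵢ) = ∏ S₁ 1 (fᵢ)` (landed `tie_beta_zero_factorises`), AND every constant field satisfies both rows.  PAPER
PART (the bridge): `S₁ 1` is translation invariant (`W1`), hence `κ·∫` (a translation-invariant distribution of
order 0 on `𝓢(ℝ⁴)`… granted E0'), so `S₁ = constField κ` on off-diagonal real tensors, hence on all of `⁰𝒮` (their
span is dense in `⁰𝒮`, `S₁ n` is continuous), and the rows read `⁰𝒮` only (`norm_fieldVec_sq`).  Together with §2a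
this exhausts the CERTIFIED inhabitants of `W1` (vacuum / `c ≡ 0`; `β ≡ 0` c-number fields): Σ holds on all of them
with `μ = 0`.  A counterexample needs `β_k ≠ 0` for all large `k` — an honest interacting lattice gauge theory. -/
theorem betaZero_slice (r : LatticeRep G) (sch : SpeciesScheme (YMSpecies G)) (hβ : ∃ᶠ k in atTop, sch.β k = 0)
    {S₁ : SchwingerFamily E4} (htie : Tie r sch S₁) :
    (∀ {n : ℕ}, n ≠ 0 → ∀ (f : Fin n → 𝓢(E4, ℝ)) (F : 𝓢((Fin n → E4), ℂ)),
        IsTensorOf F (fun i => ofRealTest (f i)) → IsOffDiagonal F →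
        ∀ (F₁ : Fin n → 𝓢((Fin 1 → E4), ℂ)), (∀ i, IsTensorOf (F₁ i) fun _ => ofRealTest (f i)) →
          S₁ n F = ∏ i, S₁ 1 (F₁ i)) ∧
      ∀ κ : ℝ, SandwichRows (constField κ) ∧
        ∀ R : E4 ≃ₗᵢ[ℝ] E4, SandwichRows (fun n => (constField κ n).comp (linActMulti R)) :=
  ⟨fun hn f F hF hF' F₁ hF₁ => tie_beta_zero_factorises r sch hβ htie hn f F hF hF' F₁ hF₁, rows_constField⟩

end BetaZero

/-- **§2d. Singular-support families (junk) satisfy the rows in every planar frame** (LANDED `sandwichRows_junk_frame`):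
all their positive-degree field vectors vanish.  So the witness that kills the model-blind cores of B, B′, T and
NPointIsotropy in Lean is BLIND to Σ (`modelBlind_conclusion_junk`). -/
theorem rows_junk :
    SandwichRows junk ∧ ∀ R : E4 ≃ₗᵢ[ℝ] E4, IsQuarterTurnFrame R → SandwichRows (fun n => (junk n).comp (linActMulti R)) :=
  modelBlind_conclusion_junk

/-! ## §3 Load-bearing analysis -/

/-- **§3a. THE TIE (paper + Lean status).**  `Σ_false_without_tie` is NOT available: the tie-free core
`SandwichModelBlind` (LANDED def; `curvatureSandwichBound_of_modelBlind`) is satisfied by EVERY family in the tree —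
`vac`, `sharp`, `phantomFamily`, `junk` (vacuum-only OS spaces: `sandwichRows_of_pairing_eq_zero`) and `constField κ`
(`μ = 0`) — and ON PAPER BY THE WHOLE QUASI-FREE CLASS WITH A SOFT KERNEL: for a generalised free field of two-point
UV degree `2Δ₂ < 10` the operator `e^{-uH} φ(f₁) e^{-vH}` splits into `a*(k_u) e^{-(u+v)H} + e^{-(u+v)H} a(k_v)` with
`‖k_u‖² = ∫σ(E) e^{-2uE} dE ≍ Mh Mh' u^{-(2Δ₂-2)}` (`σ(E) ≍ E^{2Δ₂-3}` after the transverse smearing), and the Bose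
enhancement on `n` quanta of energy `E` is `n e^{-2n(u+v)E} E^{2Δ₂-2} e^{-2uE} ≲ u^{-(2Δ₂-2)}` — NO extra `v^{-1/2}`:
the rows hold with `μ = Δ₂ − 1 < 4` exactly when the kernel is soft (the line lead's SandwichVetting-c5 reached
`max(μ₀, ½)` conservatively; both agree that `μ < 4` is not threatened).  Composite / index-locked Wick fields `φψ`:
cross terms give `u^{-(Δ_φ-1)} v^{-Δ_ψ} ≤ u^{-μ} + v^{-μ}` for `μ = Δ_φ + Δ_ψ − 1 = Δ₂ − 1` again.  CONSEQUENCE FOR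
PROVERS: unlike B/B′/T (model-blind cores FALSE in Lean by junk), a MODEL-BLIND proof of Σ from
`SoftKernel + EightFrameRP + PlanarCone (+ E0')` is NOT excluded by any known witness, and its vacuum row IS ALREADY A
THEOREM (`vacuumRow_of_kernel` below).  What a model-blind counterexample would have to be: a unitary, translation
invariant, 8-frame-RP family whose excited-state two-point functions `⟨Ψ|φ e^{-2uH} φ|Ψ⟩` are MORE singular in `u`
than the vacuum one allows after paying `v^{-μ}` for the state — incompatible with an operator product expansion /
scaling limit (identity dominates `φ × φ`), unknown in general axiomatic position.  OPEN. -/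
theorem tie_assessment : True := trivial

/-- **§3a′. The vacuum row of Σ is a model-blind THEOREM under the kernel triple** (LANDED for the sibling crux 11686:
`Summit.QuantumFields.YangMills.Theorems.NPointIsotropy.ComplexRotationBandlimit.stub_sandwichVacuumRowOfKernel`,
file `Theorems/PencilRigidityNPointIsotropySandwichVacuumRowOfKernel.lean`; exponent `μ₀ = 4 − η/2 < 4` for
`0 < η ≤ 2`, constant `√(C⁺(1 + L_η))`; the degree-`0` row `n = 0` of `SandwichBound` verbatim).  Not re-exported here
(its module is not in this file's import cone by design); cited for the provers: the `n = 0` row needs NO lattice. -/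
theorem vacuumRow_of_kernel : True := trivial

/-- **§3b. THE SOFT KERNEL is load-bearing (paper; = the parent's `threshold_tight`).**  With the tie kept, dropping
`SoftKernel` is again unfalsifiable in Lean.  Model-blind: the Gaussian `W(B₄)`-scalar `s = Σ_μ ∂_μ⁴ φ` (φ free
massive) is RP in all sixteen frames, gapped, coned, E0–E4, of two-point UV degree exactly `10` (`η = 0`, kernel
`∝ h₈(x̂)|x|⁻¹⁰`); its vacuum row forces `μ ≥ Δ₂ − 1 = 4`, so BOTH rows fail for every `μ < 4`: Σ without the soft
kernel is false on paper, and the threshold `η > 0 ⟺ μ < 4` is sharp (first Gaussian objection at `Δ = 5`). -/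
theorem softKernel_assessment : True := trivial

/-- **§3c. THE `L¹`-MASS `Mh` IS LOAD-BEARING — IN LEAN.**  The strengthened row-block `SandwichBoundSup`
(`C·Mg·Mh'·(u^{-μ}+v^{-μ})`, the `L¹` mass of `hh` dropped from the constant) fails for the constant field `κ = 1`,
every `μ`, every `C` (LANDED `not_exists_sandwichBoundSup_constField_one`: plateau profiles `hh_L`, `Mh' = 1`,
`|∫f₁| ≥ 4L² ∫g`). -/
theorem sigma_false_without_L1mass :
    ¬ ∃ μ C : ℝ, μ < 4 ∧ SandwichBoundSup (constField 1) (osReconstruction_constField 1) μ C :=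
  not_exists_sandwichBoundSup_constField_one

/-- **§3c′. THE CRUX-SHAPED SUP-NORM STRENGTHENING IS FALSE — UNCONDITIONALLY IN LEAN** (LANDED
`not_curvatureSandwichBoundSup`, support file VI): `CurvatureSandwichBoundSup` (Σ's hypotheses verbatim, first row with
`C·Mg·Mh'·(u^{-μ}+v^{-μ})`) fails at `G = SU(2)`, fundamental representation, `constScheme r 1`, `constField 1` — a
TIED family (lattice Yang–Mills at infinite coupling).  Planners: never state Σ with `Mh'` alone; the `L¹` mass of the
transverse profile is forced already by the c-number limits of the lattice theory itself. -/
theorem sigmaSup_false : ¬ CurvatureSandwichBoundSup := not_curvatureSandwichBoundSup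

/-- **§3d. THE SUP-NORM `Mh'` AND THE WINDOW `[u, 2u]` are load-bearing (paper).**  (i) With `Mh` alone in the
constant, let `hh → δ_ε` (`Mh = 1`): the vacuum row gives `‖Ψ_{f₁}‖² ≍ K(2u e₀) ≍ u^{-2Δ₂}`, forcing `μ ≥ Δ₂`; for the
curvature channel `Δ₂ = 4` (up to logarithms) this is `μ ≥ 4` — the `L∞` term `Mh'` is EXACTLY what buys the one
power of slack (`u^{2-2Δ₂}·Mh Mh'` versus `u^{-2Δ₂}·Mh²`); the would-be `tr F²` limit itself refutes the `L¹`-only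
version.  Constant fields do not see this (`|∫f₁| ≤ Mg Mh` suffices for them).  (ii) Without the window (only
`supp g ⊆ {t > 0}`, `∫|g| ≤ Mg`), `g` may concentrate at times `t → 0` at fixed `u`, and the left side grows like
`t^{-(Δ₂-1)}` against a fixed right side: false for every family with `Δ₂ > 1`; the window ties the left heat factor
`e^{-tH}`, `t ≥ u`, to the exponent.  Neither is Lean-refutable today (no tree family with `Δ₂ > 0`). -/
theorem supNorm_and_window_assessment : True := trivial

/-- **§3e. THE OTHER HYPOTHESES (paper).**  Eight-frame RP / planar cone: no role in any known argument for the `e₀`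
row (the quasi-free computation uses E2 along `e₀` only); for the quarter-turn row diagonal RP is what makes `h'`
EXIST (`inner_quantifiers_inhabited`) — without it the second conjunct is vacuously true, not false.  Gaps
(`HasMassGap`, `HasLatticeMassGap`): UV-irrelevant; the massless free field (`Δ₂ = 1`, no gap) satisfies the rows with
`μ = 0` (IR handled by `Mh`) — possibly unnecessary for Σ (they ride along in the shared package `W1`).  Hypercubic,
E3, E4, E0', hermiticity: unused by the quasi-free analysis; E0' is not needed to define the field operators here
because the row bound itself is the boundedness statement.  None of these drops is Lean-refutable with the tie kept. -/
theorem other_hypotheses_assessment : True := trivial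

/-! ## §4 Tightness -/

/-- **§4a. Σ's constant is not uniform in the family — IN LEAN** (LANDED `not_exists_uniform_sandwichBound_constField`:
for the constant fields `C ≥ c₀|κ|`).  The crux correctly puts `∃ μ C` inside `∀ G r sch S₁`. -/
theorem sigma_constant_not_uniform :
    ¬ ∃ μ C : ℝ, ∀ κ : ℝ, SandwichBound (constField κ) (osReconstruction_constField κ) μ C :=
  not_exists_uniform_sandwichBound_constField

/-- **§4b. TIGHTNESS OF THE EXPONENT AND OF THE SHAPE (paper).**  (i) On the vacuum row `μ ≥ Δ₂ − 1`: with `hh` the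
indicator of a unit disc (`Mh ≍ Mh' ≍ 1`) `‖Ψ_{f₁}‖² = ∫∫ hh hh K ≍ u^{2-2Δ₂}`; for `tr F²` (`Δ₂ = 4` up to
`log^{-2}`) `μ ≥ 3`, and the calibrated model-blind vacuum row gives `μ₀ = 4 − η/2` (`vacuumRow_of_kernel`), i.e.
`η = 2 ↦ μ₀ = 3`: no slack is wasted on the vacuum row.  (ii) Both `u^{-μ}` and `v^{-μ}` are needed: the creation part
of `φ(f₁)` is controlled by the LEFT heat factor (`a*(k_u)`), the annihilation part by the RIGHT one
(`e^{-(u+v)H} a(k_v)`, `‖k_v‖ ≍ v^{-(Δ₂-1)}` — rows with `Ψ_W` a one-particle state of energy `≍ 1/v`); a `u`-only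
bound `C u^{-μ}` is false in every family with `Δ₂ > 1`, and a symmetric product bound `C (uv)^{-μ/2}` is WEAKER than
Σ's sum at `u ≍ v` but STRONGER at `v = 1` — Σ's additive shape is the natural one (Young: `u^{-a}v^{-b} ≤
u^{-(a+b)} + v^{-(a+b)}`).  (iii) `μ` cannot be taken `< 0` even for constant fields (`u = v → 0` kills the right
side, not the left).  None is Lean-refutable today except (iii), which is uninformative. -/
theorem tightness_assessment : True := trivial

/-! ## §5 The quarter-turn row -/

/-- **§5. THE QUARTER-TURN ROW (paper + tree facts).**  For every tree family the pull-back IS the family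
(`pullback_vac`, `constField_pullback`; junk: rows in every planar frame), so the second row adds nothing there.  The
consuming line of crux 14999 needs only SOME exponent in the 45° frame (lead c6, landed
`stub_planarInvariantOfInputsWeak`), so the item's `μ < 4` there is idle for that line; ideator card
`wedge-core-frame-transfer` claims `Σ_{e₀} ⟹ Σ_{45°}` model-blindly with the same `μ` (unproved lever
`sigmaRow_pullback_of_sigmaRow`).  Refuter's reading: the 45° row is the DIAGONAL transfer-matrix statement; on the
lattice the diagonal transfer matrix of Wilson's action exists only in infinite volume (no finite 4-torus has the
diagonal mirror pair — crux D), so a lattice proof of the 45° row inherits crux D's difficulty; a counterexample to the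
45° row alone would be a Wilson limit whose `e₀`-sandwich is soft but whose diagonal-frame Hamiltonian `H' =
(H + P₁)/√2`-type generator has harder insertions — implausible given the planar cone (`H ≥ |P₁|` makes `e^{-uH'}`
comparable to `e^{-uH/√2}` on paper).  No cheap attack. -/
theorem quarterTurn_assessment : True := trivial

/-! ## §6 Regimes tried; why Σ resists -/

/-- **§6. ATTACK LEDGER (cycle 1) AND THE WALL.**
* Elaboration / typing: rc 0; `Iff.rfl` unbundling; no junk operators (`rpow` at `u, v > 0`; `Mg, Mh, Mh' ≥ 0` forced
  by the hypotheses; `h` a `Prop`; `1 + n`-degree bookkeeping fine; `∃ μ C` correctly inside `∀ S₁`).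
* Vacuity: hypotheses inhabited (§1a); inner `∀ h`, `∀ R h'` inhabited (§1b).  Triviality: no (`simp`/`positivity`
  cannot see field-vector norms; the rows are genuine inequalities between `S₁`-values).
* Degenerate inhabitants: vacuum / `c ≡ 0` (§2a), constant fields / `β ≡ 0` (§2b–c; the constant field now a
  CERTIFIED tied inhabitant of the full hypothesis set, `constField_certified`), junk / sharp / phantom (§2d) — ALL
  satisfy both rows with `μ = 0`.  Degenerate rows: `n = 0` = the vacuum row (a theorem under `K`, §3a′); `f₁ = 0`,
  null `Ψ_W` (consistent: `Ψ_W = 0 ⟹ Ψ_{f₁ ⊗ W_a} = 0` by translation invariance + totality, OS §4.1).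
* Quasi-free / Wick / index-locked classes (paper, §3a): rows hold with `μ = Δ₂ − 1` whenever the kernel is soft; the
  classes that kill B's model-blind core (`(1+εe₂)/(p²+m²)` zoo, `Σ_μ∂_μ⁴φ`, `Σ_μ:(∂_μφ_μ)²:`) are either excluded by
  the soft kernel or SATISFY Σ — anisotropy is invisible to Σ (it is a regularity statement, as the planner intended).
* Strengthenings refuted in Lean: sup-norm-only constant — row-level (§3c) AND crux-shaped with a tied witness
  (§3c′); uniform constant (§4a).  On paper: `L¹`-only, no window, `η ≥ 0` (§3b, §3d).
* Barriers: `FixedCouplingUltralocality` (consistent: c-number limits satisfy Σ), `UVStabilityNonUniqueness`,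
  `PerturbativeInvisibility`, `RegularisationDichotomy` — none bites a regularity bound along the Statement's own
  subsequence.  Negatives index: nothing on sandwich / H-bounds.
THE WALL: with the tie, a counterexample is a subsequential Wilson continuum limit of the `tr F²` strings with uniform
lattice gap and soft two-point kernel whose smeared curvature field violates a dimension-`< 5` H-bound — i.e. control
of 4D non-abelian lattice gauge theory at weak coupling exhibiting an operator dimension `≥ 5` against a two-point
dimension `< 5`, incoherent with any OPE/scaling picture.  Without the tie, the core is open but has no known
counterexample (§3a).  Σ is "true iff Yang–Mills exists as expected", and cheaper to PROVE model-blindly than its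
siblings if `SandwichModelBlind` is a theorem — the one actionable lead this cycle produces for the provers. -/
theorem regimes_tried : True := trivial

/-! ## §7 Targets — line `Sketch` (PICKED 06:09Z; skeleton v3, stubs `stub_chainGrowthAxis` / `stub_chainGrowthDiag`) -/

/-- **§7. TARGETS (the picked line's open stubs).**  The lead's LANDED equivalence
(`Theorems/IsotropyFromPowerCountingCurvatureSandwichBoundChainGrowthIff.lean`: `chainGrowthAxis_of_crux`,
`chainGrowthDiag_of_crux`, `curvatureSandwichBound_of_chainGrowth`) makes the two open stubs — normalised chain growth
`Re 𝔖(ΘW* ⊗ PᴺW) ≤ Re 𝔖(ΘW* ⊗ W)·Λ^{2N}`, `Λ = C·Mg·(Mh+Mh')·(u^{-μ}+v^{-μ})`, in the `e₀` frame and in the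
quarter-turn frame — EQUIVALENT to the item's two rows (same quantifier order: `μ, C` before the window).  Hence:
(i) no stub is weaker than the item and NO SEPARATE STUB KILL EXISTS — every finding of §1–§6 applies to the stubs
verbatim (in particular §2: on every certified inhabitant the chains are c-number, e.g. for `constField κ`
`Re 𝔖(ΘW* ⊗ PᴺW) = κ^{2N+2n}|∫f₁|^{2N}|∫W|² ≤ Re 𝔖(ΘW* ⊗ W)·(|κ|Mg(Mh+Mh'))^{2N}` by `|∫f₁| ≤ Mg Mh` — the
stub holds with `μ = 0`, consistently with `sandwichRows_constField` and the converse `chainGrowth_of_sandwich`);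
(ii) the disprover's single-sequence target proposed by the lead ("one window, one W, one N") is exactly a
violation of the item, so THE WALL of §6 is the wall for the stubs; (iii) the strengthened stub with `Mh'` alone is
FALSE (§3c′ transported through the equivalence); (iv) quasi-free calibration: chain growth rate = ‖one-particle
sandwich‖², exponent `Δ₂ − 1` (no Bose `½`, §3a), `< 4` under the kernel triple.  Nothing to land against the stubs
this cycle; `stub_chainGrowthDiag` inherits §5. -/
theorem targets_assessment : True := trivial

end Summit.QuantumFields.YangMills.Cruxes.CurvatureSandwichBound.Disproof

end
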